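import Summits.ABC.ABC.Theorems.IsogenyGlueCongruencePolyDegreeOfBoundedPrimesHeightCalibrationExact
import Summits.ABC.ABC.Theorems.IsogenyGlueCongruencePolyHeightOfBoundedPrimesStubCorePosition
import Summits.ABC.ABC.Theorems.IsogenyGlueCongruencePolyHeightOfBoundedPrimesStubPolyGenSzpiroOfPolyStrongHall
import Summits.ABC.ABC.Theorems.IsogenyGlueCongruencePolyHeightOfBoundedPrimesStubPolyStrongHallOfPolyGenSzpiro
import Summits.ABC.ABC.Theorems.IsogenyGlueCongruencePolyHeightOfBoundedPrimesStubSixLeOfPolyStrongHall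
import Literature.NumberTheory.DiophantineGeometry.StrongHall
import Literature.Barriers.ABC.HallExponentSharp

/-!
# Line `Sketch` (idea `mordell-twist-cm-height`) for crux stmt-ABC-16006 `PolyHeightOfBoundedPrimes`
— lead's skeleton v2 (prover-line-stmt-ABC-16006-0, 2026-08-16; cycle 1: 5 of 6 stubs LANDED)

The crux is `B′ = A → H` (`A = DegreePrimesPolyBounded`, `H` = polynomial height conjecture for
semistable globally minimal elliptic `W/ℚ`: `max(|Δ_W|, |c₄(W)|³) ≤ C · N_W^σ`, exponent free).
The line (planner's `Ideator2Sketch.lean`, reshaped):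

* transfer target **C⁺ = polynomial strong Hall** (B–G Conj. 12.5.3 with a FREE exponent): every
  primitive solution of `x³ − y² = z ≠ 0` has `max(|x|³, |z|) ≤ C · rad(z)^A` — registered as the CORE
  stub `stub_polyStrongHall` (conjecture-grade: ⟸ abc by `strongHall_of_abcLe` + `stub_polyStrongHall_of_strongHall`
  below; held by the lead);
* glue **C⁺ ⟹ polynomial generalized Szpiro over `ℤ`-models** (`stub_polyGenSzpiro_of_polyStrongHall`,
  B–G Thm 12.5.12 (b) ⟹ (c) with `6 + ε ↦ max(A, 6)`; tree model: `generalizedSzpiroBG_of_strongHall`);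
* proved glue `polyHeight_of_polyGenSzpiro` (`ℤ`-model polynomial Szpiro ⟹ `H`, copy of
  `polyHeight_of_generalizedSzpiroBG` with a free exponent);
* transfer stub `stub_polyHeightOfBoundedPrimes_of_polyStrongHall` (C⁺ ⟹ crux; PROVED by composition, landed by
  name p121653) and composition `PolyHeightOfBoundedPrimes_of : PolyHeightOfBoundedPrimes` — closes the crux BY NAME
  modulo the stubs in its cone {`stub_polyStrongHall`, `stub_polyGenSzpiro_of_polyStrongHall`}; hypothesis `A` idle.
  AFTER CYCLE 1 THE ONLY `sorry` LEFT IS THE CORE `stub_polyStrongHall` (conjecture-grade).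

CALIBRATION / POSITION stubs (registered, NOT in the cone of the composition; they certify what the transfer
costs) — ALL LANDED in cycle 1 (p121421, p121219, p120857), as is the glue (p121114):
* `stub_polyStrongHall_of_polyGenSzpiro` — the converse glue (exponent `2σ`, through the integral model with
  `(c₄, c₆) = (6⁴x, 6⁶y)`, `f_p ≤ 2, 8, 5`): so **C⁺ ⟺ polynomial generalized Szpiro over `ℤ`-models**;
* `stub_six_le_of_polyStrongHall` — every witness `(A, C)` of C⁺ has `A ≥ 6` (Danilov's primitive family,
  `Literature.Barriers.ABC.danilov_nat`: `0 < x³ − y² < 0.97 √x`, `gcd(x, x³ − y²) = 1`);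
* `stub_polyStrongHall_of_strongHall` (PROVED) — B–G 12.5.3 (`ε`-form) ⟹ C⁺ with `A = 9`, hence C⁺ ⟸ abc;
* `stub_not_coprimeHallSzpiro` (PROVED) — the planner's alternative hypothesis `CoprimeHallSzpiro` is false.

DROPPED from the planner's sketch: the branch through `CoprimeHallSzpiro` — that statement is FALSE as filed
(`stub_not_coprimeHallSzpiro` below: `(3·4ᵏ, 5·8ᵏ, 2·64ᵏ)`), so `stub_polyHeight_of_coprimeHallSzpiro` was vacuous.

All stub signatures are def-free (they land verbatim as `--supports` theorems).
-/

noncomputable section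

-- single-conjunct summit ABC: the duplicate ABC.ABC is mandated (CONVENTIONS §2)
set_option linter.dupNamespace false

namespace Summit.ABC.ABC.Cruxes.PolyHeightOfBoundedPrimes.MordellTwist

open IsDedekindDomain WeierstrassCurve UniqueFactorizationMonoid
open Literature.NumberTheory.DiophantineGeometry Literature.NumberTheory.EllipticCurves
open Summit.ABC.ABC.Theses.IsogenyGlueCongruence

/-! ## Registered stubs -/

/-- **CORE STUB (C⁺, conjecture-grade; lead).** Polynomial strong Hall: every primitive solution of
`x³ − y² = z ≠ 0` (B–G 12.5.2) satisfies `max(|x|³, |z|) ≤ C · rad(z)^A` for absolute `A, C`.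
Implied by abc (`stub_polyStrongHall_of_strongHall` ∘ `strongHall_of_abcLe`); forces `A ≥ 6`
(`stub_six_le_of_polyStrongHall`); equivalent to polynomial generalized Szpiro over `ℤ`-models
(`stub_polyGenSzpiro_of_polyStrongHall`, `stub_polyStrongHall_of_polyGenSzpiro`). OPEN in print. -/
theorem stub_polyStrongHall :
    ∃ A C : ℝ, ∀ x y z : ℤ, IsPrimitiveHallSolution x y z →
      ((max (|x| ^ 3) |z| : ℤ) : ℝ) ≤ C * ((radical z.natAbs : ℕ) : ℝ) ^ A := by
  sorry

/-- **GLUE STUB (in the cone; B–G Thm 12.5.12 (b) ⟹ (c) with a free exponent).** Polynomial strong Hall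
⟹ polynomial generalized Szpiro over `ℤ`-models minimal at every place: with `Γ = gcd(c₄³, c₆²) = Γ′g⁶`,
`(c₄/g², c₆/g³, 1728Δ/g⁶)` is primitive (`c_relation`), `g ∣ 72·rad g` (Cor. 12.5.7 =
`not_pow_dvd_c₄_c₆_of_isMinimalAt{,_two,_three}`), `rad(g)·rad(Δ) ∣ 6N`
(`two_le_conductorExponent_of_dvd_Δ_of_dvd_c₄`), output exponent `max(A, 6)`. Tree model:
`Literature.NumberTheory.EllipticCurves.generalizedSzpiroBG_of_strongHall` (SzpiroHallProofs). -/
theorem stub_polyGenSzpiro_of_polyStrongHall :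
    (∃ A C : ℝ, ∀ x y z : ℤ, IsPrimitiveHallSolution x y z →
      ((max (|x| ^ 3) |z| : ℤ) : ℝ) ≤ C * ((radical z.natAbs : ℕ) : ℝ) ^ A) →
    ∃ σ C : ℝ, ∀ W₀ : WeierstrassCurve ℤ, (W₀.baseChange ℚ).IsElliptic →
      (∀ v : HeightOneSpectrum ℤ, (W₀.baseChange ℚ).IsMinimalAt v) →
      ((max |W₀.Δ| (|W₀.c₄| ^ 3) : ℤ) : ℝ) ≤ C * ((W₀.baseChange ℚ).conductorNorm ℤ : ℝ) ^ σ :=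
  -- LANDED p121114 (worker W1): Theorems/IsogenyGlueCongruencePolyHeightOfBoundedPrimesStubPolyGenSzpiroOfPolyStrongHall.lean
  Summit.ABC.ABC.Theorems.PolyHeightOfBoundedPrimes.MordellTwist.stub_polyGenSzpiro_of_polyStrongHall

/-- **CALIBRATION STUB (not in the cone).** Polynomial generalized Szpiro over `ℤ`-models ⟹ polynomial
strong Hall (exponent `2σ`): for a primitive `(x, y, z)` the integral curve `Y² = X³ − 27x X − 54y` has
`(c₄, c₆, Δ) = (6⁴x, 6⁶y, 2⁶3⁹z)`; a global minimal model (`hasGlobalMinimalModel_rat_holds`) differs by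
`u ∈ ℤ` with `u⁴ ∣ 6⁴x`, `u⁶ ∣ 6⁶y`, so primitivity forces `u ∣ 6`; its conductor divides
`2⁸·3⁵·rad(z)²` (`conductorExponent_le_eight/_le_five/_le_two … _holds`, `factorization_conductorNorm_holds`,
`conductorExponent_eq_zero_of_not_dvd_Δ`). -/
theorem stub_polyStrongHall_of_polyGenSzpiro :
    (∃ σ C : ℝ, ∀ W₀ : WeierstrassCurve ℤ, (W₀.baseChange ℚ).IsElliptic →
      (∀ v : HeightOneSpectrum ℤ, (W₀.baseChange ℚ).IsMinimalAt v) →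
      ((max |W₀.Δ| (|W₀.c₄| ^ 3) : ℤ) : ℝ) ≤ C * ((W₀.baseChange ℚ).conductorNorm ℤ : ℝ) ^ σ) →
    ∃ A C : ℝ, ∀ x y z : ℤ, IsPrimitiveHallSolution x y z →
      ((max (|x| ^ 3) |z| : ℤ) : ℝ) ≤ C * ((radical z.natAbs : ℕ) : ℝ) ^ A :=
  -- LANDED p121421 (worker W2): Theorems/IsogenyGlueCongruencePolyHeightOfBoundedPrimesStubPolyStrongHallOfPolyGenSzpiro.lean
  Summit.ABC.ABC.Theorems.PolyHeightOfBoundedPrimes.MordellTwist.stub_polyStrongHall_of_polyGenSzpiro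

/-- **CALIBRATION STUB (not in the cone; tightness of C⁺).** Every witness `(A, C)` of polynomial strong
Hall has `A ≥ 6`: Danilov's Fermat–Pell family (`Literature.Barriers.ABC.danilov_nat`) gives primitive
solutions with `0 < x³ − y² < 0.97 √x` and `x → ∞` (`gcd(x, x³ − y²) = 1` since `3 ∤ x` and
`4x ≡ 1 (mod p)` for `p ∣ 2t − 1`), so `x³ ≤ C · (0.97 √x)^A` forces `A/2 ≥ 3`. -/
theorem stub_six_le_of_polyStrongHall :
    ∀ A C : ℝ, (∀ x y z : ℤ, IsPrimitiveHallSolution x y z →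
      ((max (|x| ^ 3) |z| : ℤ) : ℝ) ≤ C * ((radical z.natAbs : ℕ) : ℝ) ^ A) → 6 ≤ A :=
  -- LANDED p121219 (worker W3): Theorems/IsogenyGlueCongruencePolyHeightOfBoundedPrimesStubSixLeOfPolyStrongHall.lean
  Summit.ABC.ABC.Theorems.PolyHeightOfBoundedPrimes.MordellTwist.stub_six_le_of_polyStrongHall

/-! ## Proved glue and the composition -/

/-- **`ℤ`-model polynomial generalized Szpiro ⟹ `H`** (free-exponent copy of
`Summit.ABC.ABC.Theorems.polyHeight_of_generalizedSzpiroBG`, p111354): read `H` on `integralModelInt W`. -/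
theorem polyHeight_of_polyGenSzpiro
    (h : ∃ σ C : ℝ, ∀ W₀ : WeierstrassCurve ℤ, (W₀.baseChange ℚ).IsElliptic →
      (∀ v : HeightOneSpectrum ℤ, (W₀.baseChange ℚ).IsMinimalAt v) →
      ((max |W₀.Δ| (|W₀.c₄| ^ 3) : ℤ) : ℝ) ≤ C * ((W₀.baseChange ℚ).conductorNorm ℤ : ℝ) ^ σ) :
    ∃ σ C : ℝ, ∀ (W : WeierstrassCurve ℚ) [W.IsElliptic] [W.IsGloballyMinimal]
      [NeZero (W.conductorNorm ℤ)], W.IsSemistable ℤ →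
      ((max |W.Δ| (|W.c₄| ^ 3) : ℚ) : ℝ) ≤ C * (W.conductorNorm ℤ : ℝ) ^ σ := by
  obtain ⟨σ, C, hC⟩ := h
  refine ⟨σ, C, fun W _ _ _ _ ↦ ?_⟩
  set W₀ : WeierstrassCurve ℤ := integralModelInt W with hW₀def
  have hW₀ : W₀.baseChange ℚ = W := baseChange_integralModelInt W
  have hell : (W₀.baseChange ℚ).IsElliptic := by rw [hW₀]; infer_instance
  have hmin : ∀ v : HeightOneSpectrum ℤ, (W₀.baseChange ℚ).IsMinimalAt v := fun v ↦ by
    rw [hW₀]; exact IsGloballyMinimal.isMinimalAt_int W v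
  have hσ := hC W₀ hell hmin
  rw [hW₀] at hσ
  have hq : (max |W.Δ| (|W.c₄| ^ 3) : ℚ) = ((max |W₀.Δ| (|W₀.c₄| ^ 3) : ℤ) : ℚ) := by
    rw [← cast_integralModelInt_Δ W, ← cast_integralModelInt_c₄ W]
    push_cast
    rfl
  rw [hq, Rat.cast_intCast]
  exact hσ

/-- **The composition: the line closes the crux BY NAME** modulo the stubs in its cone
(`stub_polyStrongHall` core + `stub_polyGenSzpiro_of_polyStrongHall` glue, the latter LANDED p121114) — after
cycle 1 exactly ONE `sorry` remains in that cone: the core `stub_polyStrongHall` (C⁺). `A` is idle. -/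
theorem PolyHeightOfBoundedPrimes_of : PolyHeightOfBoundedPrimes :=
  fun _ ↦ polyHeight_of_polyGenSzpiro (stub_polyGenSzpiro_of_polyStrongHall stub_polyStrongHall)

-- TRANSFER STUB `stub_polyHeightOfBoundedPrimes_of_polyStrongHall : C⁺ → PolyHeightOfBoundedPrimes` (registered via
-- `stub-add`): LANDED p121653 as `Summit.ABC.ABC.Theorems.PolyHeightOfBoundedPrimes.stub_polyHeightOfBoundedPrimes_of_polyStrongHall`
-- (= the composition above minus its core). It is not restated here so that exactly one theorem of this file
-- concludes the crux (the skeleton checker takes the first such theorem as the composition).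

/-! ## Position of the core stub -/

/-- **Strong Hall (B–G 12.5.3, `ε`-form) ⟹ polynomial strong Hall** with `A = 9`: at `ε = 1`,
`|x| ≤ C·rad(z)³`, `|y| ≤ C·rad(z)⁴`, and `|z| ≤ |x|³ + |y|²`. Hence C⁺ ⟸ abc (`strongHall_of_abcLe`),
so C⁺ is irrefutable short of `¬abc`. -/
theorem stub_polyStrongHall_of_strongHall : StrongHallConjecture →
    ∃ A C : ℝ, ∀ x y z : ℤ, IsPrimitiveHallSolution x y z →
      ((max (|x| ^ 3) |z| : ℤ) : ℝ) ≤ C * ((radical z.natAbs : ℕ) : ℝ) ^ A :=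
  -- LANDED p120857 (lead): Theorems/IsogenyGlueCongruencePolyHeightOfBoundedPrimesStubCorePosition.lean
  Summit.ABC.ABC.Theorems.PolyHeightOfBoundedPrimes.MordellTwist.stub_polyStrongHall_of_strongHall

/-- **The planner's alternative branch is dead: `CoprimeHallSzpiro` is FALSE as filed.** The family
`(x, y, z) = (3·4ᵏ, 5·8ᵏ, 2·64ᵏ)` has `x³ − y² = z ≠ 0`, every prime dividing `x` is `≤ 3`, `rad z = 2`,
and `max(|x|³, |z|) ≥ 64ᵏ → ∞`. (The common factor `(2²ᵏ, 2³ᵏ)` is exactly the non-primitivity that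
B–G 12.5.2 excludes.) -/
theorem stub_not_coprimeHallSzpiro :
    ¬ ∃ A C : ℝ, ∀ x y z : ℤ, x ^ 3 - y ^ 2 = z → z ≠ 0 →
      (∀ p : ℕ, p.Prime → (p : ℤ) ∣ x → (p : ℤ) ∣ y → p ≤ 3) →
      ((max (|x| ^ 3) |z| : ℤ) : ℝ) ≤ C * ((radical z.natAbs : ℕ) : ℝ) ^ A :=
  -- LANDED p120857 (lead): Theorems/IsogenyGlueCongruencePolyHeightOfBoundedPrimesStubCorePosition.lean
  Summit.ABC.ABC.Theorems.PolyHeightOfBoundedPrimes.MordellTwist.stub_not_coprimeHallSzpiro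

end Summit.ABC.ABC.Cruxes.PolyHeightOfBoundedPrimes.MordellTwist

end
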